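import Summits.AtomisticToContinuum.FouriersLaw.Theses.OddSectorIrreversibility
import Literature.MathematicalPhysics.KineticTheory.OddSectorLocalityHypothesis
import Literature.MathematicalPhysics.KineticTheory.LangevinChainGibbs
import Mathlib.Probability.Distributions.Gaussian.Real

/-!
# Sketch 2 — crux idea `skew-reversible-splitting` (crux `stmt-AtomisticToContinuum-9139`, `OddCorrectorDecay`)

crux-ideate round 1, ideator 2 (gen 2), 2026-08-16.  Elaboration check.

Lever: the symmetric (Strang) splitting `S_h = O_{h/2} K_h O_{h/2}` of the crux's equilibrium kernels
into the EXACT Hamiltonian flow `K_h f = f ∘ φ_h` (deterministic, `μ_T`-preserving, `Θ`-reversible: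
`φ_{-h} = Θφ_hΘ` — all in tree: Liouville `ConfinedDrift.map_flow_volume`, reversal
`flow_reverse_apply`, energy conservation) and the EXACT Ornstein–Uhlenbeck half-steps on the two
bath momenta (a one-dimensional Gaussian kernel, reversible w.r.t. `N(0,T)` and even under `p ↦ -p`)
is EXACTLY skew-reversible at every `h > 0`: `⟨S_h f, g⟩_{μ_T} = ⟨f, Θ S_h Θ g⟩_{μ_T}` and
`μ_T S_h = μ_T`.  Since `S_{t/n}^n f → P_t f` (convergence of the splitting scheme to the tree's
pathwise solution `chainFlow`, a DETERMINISTIC numerical-analysis statement plus dominated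
convergence), dictionary clauses (1) invariance and (3) generalised detailed balance of
`OddSectorLocalityHypothesis` follow for the CONSTRUCTED `transitionKernel` — with no Girsanov
theorem, no Doob transform, no generator-domain or martingale-problem uniqueness.
-/

noncomputable section

open MeasureTheory Set Filter Topology intervalIntegral ProbabilityTheory
open Literature.MathematicalPhysics.KineticTheory.HeatConduction
open Literature.MathematicalPhysics.KineticTheory.OddSectorLocality
open Summit.AtomisticToContinuum.FouriersLaw.Theses.OddSectorIrreversibility (OddCorrectorDecay)

namespace Summit.AtomisticToContinuum.FouriersLaw.Cruxes.OddCorrectorDecay.SkewSplitting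

/-! ### The three exactly solvable pieces -/

/-- The exact Hamiltonian flow of the CLOSED pinned chain over time `h`: the tree's pathwise flow with
zero friction and zero noise path. -/
def hamStep (ω₂ lam β : ℝ) (N : ℕ) (h : ℝ) (x : PhaseSpace N) : PhaseSpace N :=
  (pinnedChain ω₂ lam β 0).chainFlow N x (fun _ => 0) h

/-- Koopman operator of the Hamiltonian step, `K_h f = f ∘ φ_h`. -/
def koopman (ω₂ lam β : ℝ) (N : ℕ) (h : ℝ) (f : PhaseSpace N → ℝ) (x : PhaseSpace N) : ℝ :=
  f (hamStep ω₂ lam β N h x)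

/-- The exact Ornstein–Uhlenbeck update of the bath momenta over time `h`, driven by a standard
Gaussian vector `ξ`: `p_i ↦ e^{-γ w_i h} p_i + √(T(1 - e^{-2γ w_i h})) ξ_i` with `w_i = bathWeight N i`
(`= 0` in the bulk, where the map is the identity). -/
def ouMap (γ T h : ℝ) (N : ℕ) (x : PhaseSpace N) (ξ : Fin N → ℝ) : PhaseSpace N :=
  (x.1, fun i => Real.exp (-(γ * OscillatorChain.bathWeight N i * h)) * x.2 i +
    Real.sqrt (T * (1 - Real.exp (-(2 * γ * OscillatorChain.bathWeight N i * h)))) * ξ i)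

/-- The thermostat (half-)step operator `O_h f (x) = E f(ouMap x ξ)`, `ξ ~ N(0, I_N)`. -/
def thermo (γ T h : ℝ) (N : ℕ) (f : PhaseSpace N → ℝ) (x : PhaseSpace N) : ℝ :=
  ∫ ξ, f (ouMap γ T h N x ξ) ∂(Measure.pi fun _ : Fin N => gaussianReal 0 1)

/-- One symmetric Strang step `S_h = O_{h/2} K_h O_{h/2}` (as an operator on observables). -/
def strang (ω₂ lam β γ T : ℝ) (N : ℕ) (h : ℝ) (f : PhaseSpace N → ℝ) : PhaseSpace N → ℝ :=
  thermo γ T (h / 2) N (koopman ω₂ lam β N h (thermo γ T (h / 2) N f))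

/-- Bounded measurable observables. -/
def IsBddMeas {N : ℕ} (f : PhaseSpace N → ℝ) : Prop := Measurable f ∧ ∃ C : ℝ, ∀ x, |f x| ≤ C

/-! ### FIRST LEMMA — the Hamiltonian step is `μ_T`-skew-adjoint under momentum reversal -/

/-- **First lemma (`HamiltonianStepSkewAdjoint`).** For the closed pinned chain and the unnormalised
Gibbs weight `w = e^{-H/T}dqdp` (`gibbsWeight`, any `γ` — `H` does not involve `γ`):
`∫ f(φ_h x) g(x) dw = ∫ f(x) g(Θ φ_h(Θx)) dw` for bounded measurable `f, g`, `h ≥ 0`,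
`Θ = momentumReversal`. Ingredients, all PROVED in tree: `φ_h` preserves Lebesgue measure
(`ConfinedDrift.map_flow_volume`, divergence `d = 0` at zero friction) and the energy
(`pinnedChain_hamiltonian_chainFlow_eq` at `γ = 0`, `η = 0`), hence `w`; it is a bijection with
inverse `φ_{-h} = Θ ∘ φ_h ∘ Θ` (`ConfinedDrift.flow_reverse_apply` + `hamiltonian_neg_momentum`);
change variables `x ↦ φ_h^{-1} x`. Size M. -/
def HamiltonianStepSkewAdjoint : Prop :=
  ∀ ω₂ lam β γ T : ℝ, 0 < ω₂ → 0 < lam → 0 < β → 0 < T → ∀ (N : ℕ) (h : ℝ), 0 ≤ h →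
    ∀ f g : PhaseSpace N → ℝ, IsBddMeas f → IsBddMeas g →
      ∫ x, f (hamStep ω₂ lam β N h x) * g x ∂(gibbsWeight ω₂ lam β γ T N) =
        ∫ x, f x * g (momentumReversal N (hamStep ω₂ lam β N h (momentumReversal N x)))
          ∂(gibbsWeight ω₂ lam β γ T N)

/-- The thermostat step is self-adjoint on `L²(w)` (the 1-d OU kernel is reversible for `N(0,T)`;
`w = e^{-Φ(q)/T}dq ⊗ ⊗_i e^{-p_i²/2T}dp_i` factorises and `O` touches `p_0, p_{N-1}` only). Size M. -/
def ThermostatSelfAdjoint : Prop :=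
  ∀ ω₂ lam β γ T : ℝ, 0 < ω₂ → 0 < lam → 0 < β → 0 < γ → 0 < T → ∀ (N : ℕ) (h : ℝ), 0 ≤ h →
    ∀ f g : PhaseSpace N → ℝ, IsBddMeas f → IsBddMeas g →
      ∫ x, thermo γ T h N f x * g x ∂(gibbsWeight ω₂ lam β γ T N) =
        ∫ x, f x * thermo γ T h N g x ∂(gibbsWeight ω₂ lam β γ T N)

/-- The thermostat step commutes with momentum reversal (`Θ ∘ ouMap x ξ = ouMap (Θx) (-ξ)` and
`ξ ↦ -ξ` preserves the standard Gaussian). Size S. -/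
def ThermostatEven : Prop :=
  ∀ γ T h : ℝ, ∀ (N : ℕ) (f : PhaseSpace N → ℝ), IsBddMeas f → ∀ x : PhaseSpace N,
    thermo γ T h N (fun y => f (momentumReversal N y)) x = thermo γ T h N f (momentumReversal N x)

/-- **Exact skew-reversibility of the Strang step**, `⟨S_h f, g⟩_w = ⟨f, Θ S_h Θ g⟩_w`, from the three
facts above (`(OKO)* = O K* O = O ΘKΘ O = Θ (OKO) Θ`), and its consequence `w S_h = w` (`g ≡ 1`).
Size S given the three. -/
def StrangSkewAdjoint : Prop :=
  ∀ ω₂ lam β γ T : ℝ, 0 < ω₂ → 0 < lam → 0 < β → 0 < γ → 0 < T → ∀ (N : ℕ) (h : ℝ), 0 ≤ h →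
    ∀ f g : PhaseSpace N → ℝ, IsBddMeas f → IsBddMeas g →
      ∫ x, strang ω₂ lam β γ T N h f x * g x ∂(gibbsWeight ω₂ lam β γ T N) =
        ∫ x, f x * strang ω₂ lam β γ T N h (fun y => g (momentumReversal N y)) (momentumReversal N x)
          ∂(gibbsWeight ω₂ lam β γ T N)

/-- **Convergence of the Strang splitting to the constructed kernels** (the analytic price):
for bounded continuous `f`, `(S_{t/n})^n f (x) → P_t f (x) = ∫ f dP_t(x,·)`. Proof plan: couple the
fresh Gaussians of the `O`-steps to the increments of the Brownian pair (`ξ = ∫e^{-γ(·)}dB`, a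
pathwise functional by integration by parts); for every continuous noise path the scheme converges
uniformly on `[0,t]` to `chainFlow x η t` (truncate the drift by `truncateField` beyond the a-priori
radius `pinnedChainRadius`, Lipschitz consistency + stability there, `pinnedChain_chainFlow_eqOn_truncSol`);
then dominated convergence and `pinnedChain_integral_transitionKernel`. Size L (hardest). -/
def StrangConvergence : Prop :=
  ∀ ω₂ lam β γ T : ℝ, 0 < ω₂ → 0 < lam → 0 < β → 0 < γ → 0 < T → ∀ (N : ℕ) (t : ℝ), 0 ≤ t →
    ∀ f : PhaseSpace N → ℝ, Continuous f → (∃ C : ℝ, ∀ x, |f x| ≤ C) → ∀ x : PhaseSpace N,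
      Tendsto (fun n : ℕ => ((strang ω₂ lam β γ T N (t / (n + 1)))^[n + 1] f) x) atTop
        (𝓝 (∫ y, f y ∂((pinnedChain ω₂ lam β γ).transitionKernel N T T t.toNNReal x)))

/-! ### The targets: dictionary (1) and (3) for the constructed kernels -/

/-- (1) `μ_T` is invariant under the constructed equilibrium kernels. -/
def KernelInvariance : Prop :=
  ∀ ω₂ lam β γ T : ℝ, 0 < ω₂ → 0 < lam → 0 < β → 0 < γ → 0 < T → ∀ (N : ℕ) (t : ℝ), 0 ≤ t →
    ∀ g : PhaseSpace N → ℝ, IsBddMeas g →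
      ∫ x, (∫ y, g y ∂((pinnedChain ω₂ lam β γ).transitionKernel N T T t.toNNReal x))
          ∂(gibbsWeight ω₂ lam β γ T N) = ∫ x, g x ∂(gibbsWeight ω₂ lam β γ T N)

/-- (3) generalised detailed balance `P_t* = Θ P_t Θ` on `L²(μ_T)`, kernel form. -/
def KernelSkewDetailedBalance : Prop :=
  ∀ ω₂ lam β γ T : ℝ, 0 < ω₂ → 0 < lam → 0 < β → 0 < γ → 0 < T → ∀ (N : ℕ) (t : ℝ), 0 ≤ t →
    ∀ f g : PhaseSpace N → ℝ, IsBddMeas f → IsBddMeas g →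
      ∫ x, f x * (∫ y, g y ∂((pinnedChain ω₂ lam β γ).transitionKernel N T T t.toNNReal x))
          ∂(gibbsWeight ω₂ lam β γ T N) =
        ∫ x, g x * (∫ y, f (momentumReversal N y)
            ∂((pinnedChain ω₂ lam β γ).transitionKernel N T T t.toNNReal (momentumReversal N x)))
          ∂(gibbsWeight ω₂ lam β γ T N)

/-- The splitting reduction (stated): exact skew-reversibility at `h > 0` passes to the limit. -/
def SplittingReduction : Prop :=
  HamiltonianStepSkewAdjoint → ThermostatSelfAdjoint → ThermostatEven → StrangConvergence →
    KernelInvariance ∧ KernelSkewDetailedBalance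

/-- The dictionary reduction (stated): (1)+(3) in kernel form give the disprover's clauses (1)–(4)
for the total current at every admissible point — Jensen/contraction for (1), Cauchy–Schwarz for
(2), the odd-norm identity `F² = 2A + 2B(2·)` for (3) (extension from bounded to the polynomial `J`
by truncation, `J ∈ L²(w)`), Fejér positivity for (4) from the Markov property
`pinnedChain_transitionKernel_add` + (1) + Fubini. Size M. -/
def DictionaryReduction : Prop :=
  KernelInvariance → KernelSkewDetailedBalance →
    ∀ ω₂ lam β γ T : ℝ, 0 < ω₂ → 0 < lam → 0 < β → 0 < γ → 0 < T → ∀ N : ℕ,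
      AntitoneOn (forecastNormSq ω₂ lam β γ T N) (Ici 0) ∧
      (∀ u : ℝ, 0 ≤ u → currentAutocorr ω₂ lam β γ T N u ≤ currentNormSq ω₂ lam β γ T N) ∧
      (∀ t : ℝ, 0 ≤ t → oddPartNormSq ω₂ lam β γ T N t =
        2 * forecastNormSq ω₂ lam β γ T N t + 2 * currentAutocorr ω₂ lam β γ T N (2 * t)) ∧
      (∀ S : ℝ, 0 < S → 0 ≤ ∫ u in (0:ℝ)..S, (S - u) * currentAutocorr ω₂ lam β γ T N u)

/-- PROVED glue: the splitting line + ANY memory line (tangent mass, or a cone) construct the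
Literature named fact on which the crux item is HELD. -/
theorem oddSectorLocalityHypothesis_of_splitting (hS : SplittingReduction) (hDict : DictionaryReduction)
    (h1 : HamiltonianStepSkewAdjoint) (h2 : ThermostatSelfAdjoint) (h3 : ThermostatEven)
    (h4 : StrangConvergence)
    (hMem : ∀ S : ℝ, 0 < S → ∃ N : ℕ, 0 < currentNormSq 1 1 1 1 1 N ∧
      currentNormSq 1 1 1 1 1 N ≤ 2 * forecastNormSq 1 1 1 1 1 N S) :
    Literature.MathematicalPhysics.KineticTheory.OddSectorLocalityHypothesis := by
  obtain ⟨hI, hB⟩ := hS h1 h2 h3 h4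
  exact ⟨1, 1, 1, 1, 1, one_pos, one_pos, one_pos, one_pos, one_pos,
    hDict hI hB 1 1 1 1 1 one_pos one_pos one_pos one_pos one_pos, hMem⟩

end Summit.AtomisticToContinuum.FouriersLaw.Cruxes.OddCorrectorDecay.SkewSplitting
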